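import Literature.Analysis.ValidatedNumerics.DigammaKernelValues
import Literature.Analysis.ValidatedNumerics.MultiPrecisionInterval
import HarnessLib

/-!
# Format D-K: the kernel checker, part 1 — data, claimed constants, terms

Cell `rh-explicit`, WEIL TRACK — GRH ARM, route B (weil-grh-3).  Computable data structures and the
Boolean checker `DKCert.check` whose soundness (`DualTrigKernelSound*.lean`) yields, for a Dirichlet
character `χ` mod `q` of parity `a` with prescribed values on the window `n ≤ N`, the pointwise inequality

  `0 ≤ M_{χ,N}(τ) + Σ_k (a_k cos(k ω τ) + b_k sin(k ω τ))`   for every real `τ`, `ω = log p₀ / D`,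

(`M_{χ,N} = weilFinitePrimeWeightChar χ N`), from which `DualTrigRung.lean` gives the rung
`WeilPositivityOnChar χ (log (N+1) / 2)`.

## The certificate and what the checker does

All real arithmetic is the tree's fixed-point interval engine `MI`/`MC` at scale `S`
(`MultiPrecisionInterval.lean`, `DigammaKernelValues.lean`: `expI`, `logNat`, `logPos`, `piMachin`,
`digammaBox`).  Write `θ = ω τ`, `y = τ/2 = ρ θ` with `ρ = D / (2 log p₀)`, `σ' = 1/4 + a/2`.

* The window terms `−2Λ(n)/√n · Re(χ(n) e^{−iτ log n})`, `n ≤ N`, and the atoms are all of the shape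
  `A cos(κ θ) + B sin(κ θ)`: powers `n = p₀^e` and atoms have INTEGER `κ` (`e·D`, `k`), the other prime
  powers have `κ = D log n / log p₀` (an interval).
* CELLS: block `b` has `Mc` cells per half-turn... precisely cell `j` of block `b` is
  `θ ∈ [2πj/Mc, 2π(j+1)/Mc]`, centre `θ_c = (2j+1)π/Mc`, covered by `θ_c + φ`, `|φ| ≤ η⁺` (`η⁺ ≥ π/Mc`
  rational).  On a cell every term is rotated to the centre (`cos κθ_c`, `sin κθ_c` from a CLAIMED table of
  `e^{iπ i/Mc}` — checked once against `expI` — for integer `κ`, from `expI` otherwise) and Taylor-expanded in `φ` to order `2R − 1`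
  with the Lagrange remainders of `cos`/`sin`; the digamma term is split as
  `Re ψ(σ'+iy) = BR(y) + Σ_{m<M₀} f_m(y)`, `f_m(y) = y²/(l(l²+y²))`, `l = m + σ'`, where `BR` is even and
  increasing in `|y|` (so `BR ≥ BR(ỹ)` for a rational `ỹ ≤ min_cell |y|`, ONE `digammaBox` per cell) and
  each `f_m` is expanded to first order at the centre with the algebraic remainder bound
  `(l² + c² + 2|c|Y)/(l(l²+c²)²) · (y − c)²`.  The resulting polynomial in `φ` with interval coefficients
  is bounded below on `2·nin` sub-cells by interval Horner evaluation.
* TAIL: beyond the covered range `Re ψ` is bounded below by monotonicity in `|y|`, the incommensurable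
  window terms by `−(|A|+|B|)`, and the commensurable part `T'` (which is `2π`-periodic in `θ`) by the
  certified minimum `mT` over one period, itself read off the cells with "period duty".

Everything in this file is a DEFINITION (total, structurally recursive, kernel-evaluable); no facts.

## References

* R. E. Moore, *Interval Analysis* (1966), Ch. 3–4 (interval extensions; the engine). [folklore]
-/

namespace Summit.Ventures.WeilGRH

open Literature.Analysis.ValidatedNumerics.NumericsMP

/-- An atom `(a/2^cden) cos(k ω τ) + (b/2^cden) sin(k ω τ)` of a format-D-K certificate. [folklore] -/
structure DKAtom where
  /-- integer frequency multiple -/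
  k : ℕ
  /-- cosine coefficient numerator -/
  a : ℤ
  /-- sine coefficient numerator -/
  b : ℤ
  deriving DecidableEq, Repr

/-- A claimed character value on the window: `n = p^e` (`p` prime, `e ≥ 1`), `χ(n) = e^{2πi u/v}`, and a
claimed bracket `slo/sden ≤ 1/√n ≤ shi/sden` (checked by squaring in `ℕ`). All checks are kernel-friendly
(no `minFac`, no well-founded recursion). [folklore] -/
structure DKVal where
  /-- the prime power `n ≤ N`, coprime to `q` -/
  n : ℕ
  /-- its prime -/
  p : ℕ
  /-- its exponent `e ≥ 1`, `p^e = n` -/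
  e : ℕ
  /-- `χ(n) = exp(2πi u/v)` -/
  u : ℤ
  /-- denominator `v ≥ 1` -/
  v : ℕ
  /-- numerator of the lower bracket of `1/√n` -/
  slo : ℕ
  /-- numerator of the upper bracket of `1/√n` -/
  shi : ℕ
  /-- common denominator `sden ≥ 1` of the bracket -/
  sden : ℕ
  deriving DecidableEq, Repr

/-- A block of cells: cells `j0 ≤ j < j0 + n`, cell `j` = `{θ ∈ [2πj/Mc, 2π(j+1)/Mc]}`, each bounded on
`2·nin` sub-cells of `[−η⁺, η⁺]`, `η⁺ = etaNum/etaDen ≥ π/Mc`. [folklore] -/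
structure DKBlock where
  /-- cells per `2π` -/
  Mc : ℕ
  /-- first cell index -/
  j0 : ℤ
  /-- number of cells -/
  n : ℕ
  /-- half the number of inner sub-cells -/
  nin : ℕ
  /-- numerator of `η⁺` -/
  etaNum : ℕ
  /-- denominator of `η⁺` -/
  etaDen : ℕ
  /-- CLAIMED enclosures `(re.lo, re.hi, im.lo, im.hi)` (scaled by `S`) of `e^{iπ i/Mc}`, `i < Mc`, in rows
  of length `DKCert.rowW` (checked once against `expI`; entries `Mc ≤ i < 2Mc` by negation) -/
  tab : List (List (ℤ × ℤ × ℤ × ℤ))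
  deriving DecidableEq, Repr

/-- A format-D-K certificate. [folklore] -/
structure DKCert where
  /-- fixed-point scale of the interval engine -/
  S : ℕ
  /-- series length for `expI`, `log`, `arctan` -/
  Kser : ℕ
  /-- halvings in `expI` -/
  kexp : ℕ
  /-- log-series length inside `digammaBox` -/
  Kdig : ℕ
  /-- Stirling shift `J` inside `digammaBox` -/
  Jdig : ℕ
  /-- modulus -/
  q : ℕ
  /-- parity `a ∈ {0, 1}` -/
  par : ℕ
  /-- window `n ≤ N` -/
  N : ℕ
  /-- base prime of the frequency unit `ω = log p0 / D` -/
  p0 : ℕ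
  /-- divisor `D ≥ 1` -/
  D : ℕ
  /-- coefficient scale `2^cden` of the atoms -/
  cden : ℕ
  /-- claimed character values on the window -/
  vals : List DKVal
  /-- the atoms -/
  atoms : List DKAtom
  /-- `true` if the multiplier inequality is even in `τ` (real data, cosine atoms) -/
  even : Bool
  /-- Taylor order: expansion to degree `2R − 1` -/
  R : ℕ
  /-- number of leading vertical-series terms of `Re ψ` treated explicitly -/
  M0 : ℕ
  /-- the cell blocks, contiguous, in increasing order of `θ` -/
  blocks : List DKBlock
  /-- claimed lower bound (scaled by `S`) of the commensurable part over one period -/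
  mT : ℤ
  /-- CLAIMED enclosure of `π` (scaled endpoints; checked once against `piMachin`) -/
  piC : ℤ × ℤ
  /-- CLAIMED enclosure of `log p0` -/
  logp0C : ℤ × ℤ
  /-- CLAIMED enclosure of `ρ = D/(2 log p0)` -/
  rhoC : ℤ × ℤ
  /-- CLAIMED enclosure of `log q − log π` -/
  constC : ℤ × ℤ
  deriving Repr

namespace DKCert

variable (c : DKCert)

/-! ### Global constants of a certificate

The transcendental constants are CLAIMED in the data (so that the kernel reads literals in every cell)
and CHECKED once against the engine: a claimed interval must contain the engine's enclosure. -/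

/-- The default value for failed `Option`s (never used: every use is guarded by a check). [folklore] -/
def dft : MI := ⟨0, 0⟩

/-- A pair of scaled endpoints as an interval. [folklore] -/
def ofPair (p : ℤ × ℤ) : MI := ⟨p.1, p.2⟩

/-- `J ⊆ I` for intervals (so membership transfers from `J` to `I`). [folklore] -/
def encl (I J : MI) : Bool := decide (I.lo ≤ J.lo) && decide (J.hi ≤ I.hi)

/-- `π` (claimed). [folklore] -/
def piI : MI := ofPair c.piC

/-- `log p0` (claimed). [folklore] -/
def logp0I : MI := ofPair c.logp0C

/-- `ρ = D / (2 log p0)` (claimed; `y = τ/2 = ρ θ`). [folklore] -/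
def rhoI : MI := ofPair c.rhoC

/-- `σ' = 1/4 + a/2`. [folklore] -/
def sigI : MI := MI.ofFrac c.S (1 + 2 * c.par) 4

/-- `log q − log π` (claimed). [folklore] -/
def constI : MI := ofPair c.constC

/-- The claimed constants contain the engine's enclosures, and basic shape conditions. [folklore] -/
def constsOK : Bool :=
  decide (0 < c.S) && decide (2 ≤ c.p0) && decide (1 ≤ c.D) && decide (c.par ≤ 1) && decide (1 ≤ c.R) &&
  decide (0 < c.logp0I.lo) && decide (0 < c.piI.lo) && decide (0 < c.rhoI.lo) &&
  (match MI.piMachin c.S c.Kser with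
    | some P => encl c.piI P
    | none => false) &&
  (match MI.logNat c.S c.Kser c.p0 with
    | some L => encl c.logp0I L &&
      (match MI.divPos c.S (MI.ofInt c.S c.D) (L.mulInt 2) with
        | some R => encl c.rhoI R
        | none => false)
    | none => false) &&
  (match MI.logNat c.S c.Kser c.q, MI.logPos c.S c.Kser c.piI with
    | some Lq, some Lpi => encl c.constI (Lq.sub Lpi)
    | _, _ => false)

/-! ### Terms `A cos(κθ) + B sin(κθ)` -/

/-- A term of the multiplier inequality in the variable `θ = ωτ`: integer frequency `k` (if `isInt`)
or interval frequency `rI`, coefficient boxes `A`, `B`, the powers `κ^m`, `m ≤ 2R+1`, and whether it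
belongs to the periodic (commensurable) part. [folklore] -/
structure GTerm where
  /-- integer frequency (meaningful if `isInt`) -/
  k : ℕ
  /-- `true` for integer frequency -/
  isInt : Bool
  /-- enclosure of the frequency `κ` -/
  rI : MI
  /-- cosine coefficient -/
  A : MI
  /-- sine coefficient -/
  B : MI
  /-- `κ^0, κ^1, …, κ^(2R+1)` (enclosures; used for non-integer frequencies and the remainders) -/
  kpow : List MI
  /-- `κ^0, κ^1, …, κ^(2R+1)` as exact integers (used when `isInt`) -/
  kpowZ : List ℤ
  /-- part of the periodic part `T'` -/
  comm : Bool

/-- Powers `X^0, …, X^m` as a list. [folklore] -/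
def powList (S : ℕ) (X : MI) : ℕ → List MI
  | 0 => [MI.ofInt S 1]
  | m + 1 => let l := powList S X m; l ++ [MI.mul S (l.getLastD (MI.ofInt S 1)) X]

/-- The term of an atom. [folklore] -/
def atomTerm (atm : DKAtom) : GTerm :=
  let kI := MI.ofInt c.S atm.k
  { k := atm.k, isInt := true, rI := kI,
    A := MI.ofFrac c.S atm.a (2 ^ c.cden), B := MI.ofFrac c.S atm.b (2 ^ c.cden),
    kpow := powList c.S kI (2 * c.R + 1), kpowZ := (List.range (2 * c.R + 2)).map fun m => (atm.k : ℤ) ^ m,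
    comm := true }

/-- `e` with `p0^e = n`, if any (search up to `n`). [folklore] -/
def logExact (p0 n : ℕ) : Option ℕ :=
  ((List.range (n + 1)).find? fun e => p0 ^ e == n)

/-- `2π u/v` as an interval. [folklore] -/
def angleI (u : ℤ) (v : ℕ) : MI := ((c.piI.mulInt (2 * u)).divNat v)

/-- The box of `χ(n) = e^{2πiu/v}`. [folklore] -/
def chiBox (val : DKVal) : Option MC := MC.expI c.S c.Kser c.kexp c.piI (c.angleI val.u val.v)

/-- The term of a window value `n = p^e`: `A = −2 log p/√n · Re χ(n)`, `B = −2 log p/√n · Im χ(n)`,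
frequency `e·D` if `p = p0`, else `D log n / log p0`. [folklore] -/
def valTerm (val : DKVal) : Option GTerm :=
  match MI.logNat c.S c.Kser val.p, c.chiBox val, MI.logNat c.S c.Kser val.n with
  | some L, some X, some Ln =>
    let sI : MI := ⟨(MI.ofFrac c.S val.slo val.sden).lo, (MI.ofFrac c.S val.shi val.sden).hi⟩
    let alpha := (MI.mul c.S L sI).mulInt 2          -- 2 log p / √n
    let A := (MI.mul c.S alpha X.re).neg
    let B := (MI.mul c.S alpha X.im).neg
    match logExact c.p0 val.n with
    | some e =>
      let kI := MI.ofInt c.S (e * c.D : ℕ)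
      some { k := e * c.D, isInt := true, rI := kI, A := A, B := B,
             kpow := powList c.S kI (2 * c.R + 1),
             kpowZ := (List.range (2 * c.R + 2)).map fun m => ((e * c.D : ℕ) : ℤ) ^ m, comm := true }
    | none =>
      match MI.divPos c.S (Ln.mulInt c.D) c.logp0I with
      | some r => some { k := 0, isInt := false, rI := r, A := A, B := B,
                         kpow := powList c.S r (2 * c.R + 1), kpowZ := [], comm := false }
      | none => none
  | _, _, _ => none

/-- All window terms (or `none`). [folklore] -/
def valTerms : Option (List GTerm) := (c.vals.map c.valTerm).mapM id

/-- All terms: atoms and window terms. [folklore] -/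
def terms : List GTerm := (c.atoms.map c.atomTerm) ++ (c.valTerms.getD [])

/-- Kernel-friendly primality test (trial division, structural recursion on a fuel argument). [folklore] -/
def noDivAux (p : ℕ) : ℕ → Bool
  | 0 => true
  | d + 1 => if d + 1 < 2 then true else (p % (d + 1) != 0) && noDivAux p d

/-- `isPrimeB p`: `2 ≤ p` and no `d` with `2 ≤ d < p` divides `p`. [folklore] -/
def isPrimeB (p : ℕ) : Bool := decide (2 ≤ p) && noDivAux p (p - 1)

/-- Kernel-friendly prime-power test: some `p ≤ n`, `1 ≤ e ≤ n` with `p` prime and `p^e = n`. [folklore] -/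
def isPrimePowB (n : ℕ) : Bool :=
  (List.range (n + 1)).any fun p => isPrimeB p && (List.range (n + 1)).any fun e => decide (1 ≤ e) && p ^ e == n

/-- Kernel-friendly coprimality (Euclid with fuel). [folklore] -/
def gcdFuel : ℕ → ℕ → ℕ → ℕ
  | 0, a, _ => a
  | _ + 1, a, 0 => a
  | f + 1, a, b + 1 => gcdFuel f (b + 1) (a % (b + 1))

/-- `coprimeB a b ↔ gcd a b = 1` (proved in the soundness file). [folklore] -/
def coprimeB (a b : ℕ) : Bool := gcdFuel (a + b + 1) a b == 1

/-- Checks on the window data: every val is `n = p^e ≤ N` with `p` prime, `e ≥ 1`, coprime to `q`, with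
`v, sden ≥ 1` and a valid `1/√n` bracket; every `n ≤ N` is listed, or not coprime to `q`, or not a prime
power; `valTerms` succeeded; in the even case all sine data vanish. [folklore] -/
def valsOK : Bool :=
  c.valTerms.isSome &&
  (c.vals.all fun val =>
    isPrimeB val.p && decide (1 ≤ val.e) && (val.p ^ val.e == val.n) && decide (val.n ≤ c.N) &&
    coprimeB val.n c.q && decide (1 ≤ val.v) && decide (1 ≤ val.sden) &&
    decide (val.slo ^ 2 * val.n ≤ val.sden ^ 2) && decide (val.sden ^ 2 ≤ val.shi ^ 2 * val.n)) &&
  ((List.range (c.N + 1)).all fun n =>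
    (c.vals.any fun val => val.n == n) || !coprimeB n c.q || !isPrimePowB n) &&
  (!c.even || ((c.atoms.all fun atm => atm.b == 0) && c.vals.all fun val => (2 * val.u) % (val.v : ℤ) == 0))

end DKCert

end Summit.Ventures.WeilGRH
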